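import Literature.Topology.FourManifolds.GroupTrisections
import Mathlib.GroupTheory.SpecificGroups.Cyclic
import HarnessLib

/-!
# Stub `stub_latticeIdentity` of line `epi-class-livingston` for crux `CongruenceShadows.ShadowApproximation`
(item stmt-SmoothPoincare4-14595, route route-SmoothPoincare4-CongruenceShadows)

The **lattice identity** at type `(3,1)`: for every `(3,1)` group trisection `K` of the trivial
group (Abrams–Gay–Kirby 2018, Def. 1, kernel form `IsGroupTrisection 3 1 PUnit K`) and every
labelling `{i, j, l} = {0, 1, 2}`,

  `⁅S₃, S₃⁆ ≤ Kᵢ ⊔ (Kⱼ ⊓ Kₗ)`.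

It is an instance of a purely group-theoretic statement (`commutator_top_le_sup_inf`): if `A B C`
are normal subgroups of a group `G` with `A ⊔ B ⊔ C = ⊤` and both `G ⧸ (A ⊔ B)` and `G ⧸ (A ⊔ C)`
cyclic, then `⁅G, G⁆ ≤ A ⊔ (B ⊓ C)`.  Proof: put `W = A ⊔ (B ⊓ C)` (normal) and work in
`Q = G ⧸ W`.  The images `B̄`, `C̄` of `B`, `C` commute elementwise (`⁅B, C⁆ ≤ B ⊓ C ≤ W`) and
generate `Q` (`A ↦ 1`).  `Q ⧸ C̄` is a quotient of `G ⧸ (A ⊔ C)`, hence cyclic, and the kernel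
`B̄ ⊓ C̄` of `B̄ → Q ⧸ C̄` is central in `B̄` (it lies in `C̄`, which commutes with `B̄`); a
central-by-cyclic group is abelian, so `B̄` is abelian, and likewise `C̄`.  Two elementwise
commuting abelian subgroups generating `Q` make `Q` abelian, i.e. `⁅G, G⁆ ≤ W`.

For the trisection: the `Kᵢ` are normal (`IsGroupTrisection.normal`), `K i ⊔ K j ⊔ K l = ⊤`
because the triple quotient `S₃ ⧸ ⟪⋃ Kₜ⟫ ≅ PUnit` is trivial (`IsGroupTrisection.triple`) and
`{i, j, l}` exhausts `Fin 3`, and `S₃ ⧸ (K a ⊔ K b) = S₃ ⧸ ⟪K a ∪ K b⟫ ≅ F₁` is cyclic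
(`IsGroupTrisection.free_pairQuotient`, rank `1`).  All of it is elementary group theory. [folklore]
-/

-- the prescribed namespace `Summit.<P>.<Sub>.…` duplicates `SmoothPoincare4` (P = Sub)
set_option linter.dupNamespace false
noncomputable section
open Subgroup Literature.Topology.FourManifolds

namespace Summit.SmoothPoincare4.SmoothPoincare4.Theorems.ShadowApproximation.EpiClassLivingston

section Helpers

variable {Q : Type*} [Group Q]

/-- If the subgroups `B`, `C` of `Q` commute elementwise, `C` is normal and `Q ⧸ C` is cyclic,
then `B` is commutative: the kernel of `B → Q ⧸ C` lies in `C`, hence is central in `B`, and a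
central-by-cyclic group is abelian. [folklore] -/
private theorem comm_of_commuting_of_isCyclic_quotient (B C : Subgroup Q) [C.Normal]
    [IsCyclic (Q ⧸ C)] (hBC : ∀ b ∈ B, ∀ c ∈ C, b * c = c * b) :
    ∀ x ∈ B, ∀ y ∈ B, x * y = y * x := by
  have key : ((QuotientGroup.mk' C).comp B.subtype).ker ≤ Subgroup.center B := by
    rintro ⟨z, hz⟩ hz1
    rw [MonoidHom.mem_ker, MonoidHom.comp_apply, Subgroup.subtype_apply, QuotientGroup.mk'_apply,
      QuotientGroup.eq_one_iff] at hz1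
    rw [Subgroup.mem_center_iff]
    rintro ⟨w, hw⟩
    exact Subtype.ext (hBC w hw z hz1)
  have hcomm :=
    ((QuotientGroup.mk' C).comp B.subtype).isMulCommutative_of_isCyclic_of_ker_le_center key
  intro x hx y hy
  exact congrArg Subtype.val (hcomm.is_comm.comm ⟨x, hx⟩ ⟨y, hy⟩)

/-- A group generated by two elementwise commuting normal subgroups `B`, `C` with both quotients
`Q ⧸ B`, `Q ⧸ C` cyclic is commutative. [folklore] -/
private theorem comm_of_sup_eq_top (B C : Subgroup Q) [B.Normal] [C.Normal]
    [IsCyclic (Q ⧸ B)] [IsCyclic (Q ⧸ C)] (hBC : ∀ b ∈ B, ∀ c ∈ C, b * c = c * b)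
    (htop : B ⊔ C = ⊤) (x y : Q) : x * y = y * x := by
  have hB := comm_of_commuting_of_isCyclic_quotient B C hBC
  have hC := comm_of_commuting_of_isCyclic_quotient C B (fun c hc b hb => (hBC b hb c hc).symm)
  have hmem : ∀ q : Q, ∃ b ∈ B, ∃ c ∈ C, b * c = q := by
    intro q
    have hq : q ∈ ((B ⊔ C : Subgroup Q) : Set Q) := by
      rw [htop, Subgroup.coe_top]
      exact Set.mem_univ q
    rw [Subgroup.mul_normal] at hq
    exact Set.mem_mul.mp hq
  obtain ⟨b₁, hb₁, c₁, hc₁, rfl⟩ := hmem x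
  obtain ⟨b₂, hb₂, c₂, hc₂, rfl⟩ := hmem y
  calc b₁ * c₁ * (b₂ * c₂) = b₁ * (c₁ * b₂) * c₂ := by simp only [mul_assoc]
    _ = b₁ * (b₂ * c₁) * c₂ := by rw [hBC b₂ hb₂ c₁ hc₁]
    _ = (b₁ * b₂) * (c₁ * c₂) := by simp only [mul_assoc]
    _ = (b₂ * b₁) * (c₂ * c₁) := by rw [hB b₁ hb₁ b₂ hb₂, hC c₁ hc₁ c₂ hc₂]
    _ = b₂ * (b₁ * c₂) * c₁ := by simp only [mul_assoc]
    _ = b₂ * (c₂ * b₁) * c₁ := by rw [hBC b₁ hb₁ c₂ hc₂]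
    _ = b₂ * c₂ * (b₁ * c₁) := by simp only [mul_assoc]

/-- **The abstract lattice identity.** For normal subgroups `A B C` of `G` with `A ⊔ B ⊔ C = ⊤`
and `G ⧸ (A ⊔ B)`, `G ⧸ (A ⊔ C)` cyclic, `⁅G, G⁆ ≤ A ⊔ (B ⊓ C)`: in `G ⧸ (A ⊔ (B ⊓ C))` the
images of `B` and `C` commute elementwise, generate, and are central-by-cyclic, hence abelian.
[folklore] -/
theorem commutator_top_le_sup_inf {G : Type*} [Group G] (A B C : Subgroup G)
    [A.Normal] [B.Normal] [C.Normal] (htop : A ⊔ B ⊔ C = ⊤)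
    [IsCyclic (G ⧸ (A ⊔ B))] [IsCyclic (G ⧸ (A ⊔ C))] :
    ⁅(⊤ : Subgroup G), (⊤ : Subgroup G)⁆ ≤ A ⊔ (B ⊓ C) := by
  set W : Subgroup G := A ⊔ (B ⊓ C) with hW
  set π : G →* G ⧸ W := QuotientGroup.mk' W with hπ
  have hπs : Function.Surjective π := QuotientGroup.mk'_surjective W
  have hπ1 : ∀ g, π g = 1 ↔ g ∈ W := fun g => by
    rw [hπ, QuotientGroup.mk'_apply, QuotientGroup.eq_one_iff]
  haveI hBn : (B.map π).Normal := Subgroup.Normal.map inferInstance π hπs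
  haveI hCn : (C.map π).Normal := Subgroup.Normal.map inferInstance π hπs
  have hAπ : A.map π = ⊥ := by
    rw [Subgroup.map_eq_bot_iff, hπ, QuotientGroup.ker_mk']
    exact le_sup_left
  -- the images of `B` and `C` commute elementwise
  have hBC : ∀ b ∈ B.map π, ∀ c ∈ C.map π, b * c = c * b := by
    rintro _ ⟨g, hg, rfl⟩ _ ⟨h, hh, rfl⟩
    rw [← commutatorElement_eq_one_iff_mul_comm, ← map_commutatorElement, hπ1]
    exact Subgroup.mem_sup_right
      (Subgroup.commutator_le_inf B C (Subgroup.commutator_mem_commutator hg hh))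
  -- and generate the quotient
  have htop' : B.map π ⊔ C.map π = ⊤ := by
    have h := congrArg (Subgroup.map π) htop
    rw [Subgroup.map_sup, Subgroup.map_sup, hAπ, bot_sup_eq,
      Subgroup.map_top_of_surjective π hπs] at h
    exact h
  -- the quotients by the images are cyclic
  have hcyc : ∀ (D : Subgroup G) [D.Normal] [(D.map π).Normal], IsCyclic (G ⧸ (A ⊔ D)) →
      IsCyclic ((G ⧸ W) ⧸ D.map π) := by
    intro D _ _ hD
    have hle : A ⊔ D ≤ (D.map π).comap π := by
      refine sup_le ?_ (Subgroup.le_comap_map π D)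
      intro a ha
      rw [Subgroup.mem_comap, (hπ1 a).mpr (Subgroup.mem_sup_left ha)]
      exact one_mem _
    exact isCyclic_of_surjective (QuotientGroup.map (A ⊔ D) (D.map π) π hle)
      (QuotientGroup.map_surjective_of_surjective (A ⊔ D) (D.map π) π
        (QuotientGroup.mk_surjective.comp hπs) hle)
  haveI := hcyc B inferInstance
  haveI := hcyc C inferInstance
  have hcomm := comm_of_sup_eq_top (B.map π) (C.map π) hBC htop'
  rw [Subgroup.commutator_le]
  intro g _ h _
  rw [← hπ1, map_commutatorElement, commutatorElement_eq_one_iff_mul_comm]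
  exact hcomm (π g) (π h)

/-- Three pairwise distinct elements exhaust `Fin 3`. [folklore] -/
private theorem fin_three_cover :
    ∀ i j l t : Fin 3, i ≠ j → j ≠ l → i ≠ l → t = i ∨ t = j ∨ t = l := by
  decide

/-- For normal subgroups `P`, `R`, the normal closure `⟪P ∪ R⟫` is `P ⊔ R`. [folklore] -/
private theorem normalClosure_union_eq_sup {S : Type*} [Group S] (P R : Subgroup S)
    [P.Normal] [R.Normal] : normalClosure ((P : Set S) ∪ R) = P ⊔ R := by
  apply le_antisymm
  · exact Subgroup.normalClosure_le_normal
      (Set.union_subset (fun x hx => Subgroup.mem_sup_left hx)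
        (fun x hx => Subgroup.mem_sup_right hx))
  · exact sup_le (fun x hx => Subgroup.subset_normalClosure (Set.mem_union_left _ hx))
      (fun x hx => Subgroup.subset_normalClosure (Set.mem_union_right _ hx))

/-- If `S ⧸ ⟪P ∪ R⟫` is free of rank `1` (so `≅ ℤ`) for normal `P`, `R`, then `S ⧸ (P ⊔ R)` is
cyclic. [folklore] -/
private theorem isCyclic_quotient_sup {S : Type*} [Group S] (P R : Subgroup S)
    [P.Normal] [R.Normal] (h : IsFreeOfRank (S ⧸ normalClosure ((P : Set S) ∪ R)) 1) :
    IsCyclic (S ⧸ (P ⊔ R)) := by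
  obtain ⟨e⟩ := h
  haveI : IsCyclic (S ⧸ normalClosure ((P : Set S) ∪ R)) := isCyclic_of_surjective e e.surjective
  exact isCyclic_of_surjective _
    (QuotientGroup.quotientMulEquivOfEq (normalClosure_union_eq_sup P R)).surjective

end Helpers

/-- **Lattice identity at type `(3,1)`** (stub `stub_latticeIdentity`, 1a, of the line
`epi-class-livingston`): for every `(3,1)` group trisection `K` of the trivial group and every
labelling `{i, j, l} = {0, 1, 2}`, `⁅S₃, S₃⁆ ≤ Kᵢ ⊔ (Kⱼ ⊓ Kₗ)`.  Instance of
`commutator_top_le_sup_inf`: the kernels are normal, `K i ⊔ K j ⊔ K l = ⊤` since the triple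
quotient is trivial, and `S₃ ⧸ (K a ⊔ K b) ≅ F₁` is cyclic. [folklore] -/
theorem stub_latticeIdentity :
    ∀ K : TrisectionKernels 3, IsGroupTrisection 3 1 (PUnit : Type) K →
      ∀ i j l : Fin 3, i ≠ j → j ≠ l → i ≠ l →
        ⁅(⊤ : Subgroup (SurfaceGroup 3)), (⊤ : Subgroup (SurfaceGroup 3))⁆ ≤ K i ⊔ (K j ⊓ K l) := by
  intro K hK i j l hij hjl hil
  haveI : ∀ t, (K t).Normal := hK.normal
  have htop : K i ⊔ K j ⊔ K l = ⊤ := by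
    obtain ⟨e⟩ := hK.triple
    have hsub : Subsingleton K.tripleQuotient := e.toEquiv.subsingleton
    rw [QuotientGroup.subsingleton_iff] at hsub
    rw [eq_top_iff, ← hsub]
    refine Subgroup.normalClosure_le_normal ?_
    intro x hx
    obtain ⟨t, ht⟩ := Set.mem_iUnion.mp hx
    rcases fin_three_cover i j l t hij hjl hil with rfl | rfl | rfl
    · exact Subgroup.mem_sup_left (Subgroup.mem_sup_left ht)
    · exact Subgroup.mem_sup_left (Subgroup.mem_sup_right ht)
    · exact Subgroup.mem_sup_right ht
  haveI := isCyclic_quotient_sup (K i) (K j) (hK.free_pairQuotient i j hij)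
  haveI := isCyclic_quotient_sup (K i) (K l) (hK.free_pairQuotient i l hil)
  exact commutator_top_le_sup_inf (K i) (K j) (K l) htop

end Summit.SmoothPoincare4.SmoothPoincare4.Theorems.ShadowApproximation.EpiClassLivingston
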